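import Literature.NumberTheory.NumberFields.PrescribedSignsAtRealPlaces
import Literature.NumberTheory.GaloisCohomology.CorrectionAtPArithmetic
import HarnessLib

/-!
# Elements with prescribed congruences, orders AND signs at the real places (approximation theorem)

The approximation theorem for a number field `K` at finitely many finite places together with the
real places (Neukirch, *Algebraic Number Theory* II (3.4); the Chinese remainder theorem with signs):

* `exists_valuation_sub_one_lt_and_forall_isReal_sign` — for a finite set `P` of finite places and a
  set `N` of infinite places there is `t ∈ Kˣ` with `t ≡ 1 (mod 𝔭_v)` for `v ∈ P`, `t <_w 0` at the
  real `w ∈ N` and `t >_w 0` at the real `w ∉ N`.  Proof: `t = 1 + M·D·y` with `y ∈ 𝓞_K` of the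
  prescribed signs (`exists_forall_isReal_sign`, cleared of denominators), `M = ∏_{v ∈ P} N(𝔭_v) ∈ 𝔭_v`,
  and `D ∈ ℕ` large enough that `|M D y|_w > 1` at every real place;
* `exists_ord_eq_and_valuation_sub_one_lt_and_pos` — **the CRT element of Tate's correction at `p`,
  made TOTALLY POSITIVE**: prescribed orders at `S`, `≡ 1` at `T`, and positive at every real place
  (`exists_ord_eq_and_valuation_sub_one_lt` times a `t ≡ 1 (mod S ∪ T)` of the same signs).  Over a
  field with real places this is what makes the auxiliary cyclic classes `κ(a) ∪ ψ` of the correction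
  vanish at the real places and their archimedean Artin symbols trivial (the `2`-primary part of the
  reciprocity law `∑_v inv_v = 0`).

Proof file: theorems only (no definition, no named fact, no instance; D-0026).

## References

* J. Neukirch, *Algebraic Number Theory* (1999), Ch. II §3 Thm. (3.4) (approximation theorem),
  Ch. I §3 Thm. (3.6) (Chinese remainder theorem). [NeukirchANT1999]
* J. Tate, *Global class field theory*, Ch. VII of Cassels–Fröhlich (1967), §11. [CasselsFrohlichANT1967]
-/

noncomputable section

open NumberField IsDedekindDomain Field
open scoped NumberField

namespace Literature.NumberTheory.NumberFields

open Literature.NumberTheory.GaloisRepresentations.LocalWeilDatum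
open Literature.NumberTheory.GaloisCohomology

variable (K : Type) [Field K] [NumberField K]

/-- A nonzero `y ∈ K` has a positive integer multiple in `𝓞_K`: `d • y ∈ 𝓞_K`, `d ∈ ℕ`, `0 < d`
(write `y = x / z` with `x, z ∈ 𝓞_K` and take `d = N(z)`, which `z` divides). [folklore] -/
private theorem exists_nat_mul_mem_ringOfIntegers (y : K) :
    ∃ (d : ℕ) (r : 𝓞 K), 0 < d ∧ (d : K) * y = r := by
  obtain ⟨x, z, hz, hxz⟩ := IsFractionRing.div_surjective (A := 𝓞 K) y
  have hz0 : z ≠ 0 := nonZeroDivisors.ne_zero hz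
  set d : ℕ := Ideal.absNorm (Ideal.span {z}) with hd
  have hdmem : (d : 𝓞 K) ∈ Ideal.span {z} := Ideal.absNorm_mem _
  obtain ⟨c, hc⟩ := Ideal.mem_span_singleton'.mp hdmem
  have hd0 : d ≠ 0 := by
    rw [hd, ne_eq, Ideal.absNorm_eq_zero_iff, Ideal.span_singleton_eq_bot]
    exact hz0
  refine ⟨d, c * x, Nat.pos_of_ne_zero hd0, ?_⟩
  have hzK : (algebraMap (𝓞 K) K z) ≠ 0 :=
    (map_ne_zero_iff _ (IsFractionRing.injective (𝓞 K) K)).mpr hz0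
  have h := congrArg (algebraMap (𝓞 K) K) hc
  rw [map_mul, map_natCast] at h
  rw [← hxz, ← h]
  change _ = algebraMap (𝓞 K) K (c * x)
  calc algebraMap (𝓞 K) K c * algebraMap (𝓞 K) K z * (algebraMap (𝓞 K) K x / algebraMap (𝓞 K) K z)
        = algebraMap (𝓞 K) K c * algebraMap (𝓞 K) K x * (algebraMap (𝓞 K) K z / algebraMap (𝓞 K) K z) := by
          ring
    _ = algebraMap (𝓞 K) K (c * x) := by rw [div_self hzK, mul_one, map_mul]

/-- **Congruences at finitely many finite places together with prescribed real signs** (approximation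
theorem): for a finite set `P` of finite places and a set `N` of infinite places of `K` there is
`t ∈ K`, `t ≠ 0`, with `|t - 1|_v < 1` for `v ∈ P`, `t <_w 0` at the real places `w ∈ N` and `t >_w 0`
at the real places `w ∉ N`. [cite: NeukirchANT1999, Ch. II §3 Thm. (3.4)] -/
theorem exists_valuation_sub_one_lt_and_forall_isReal_sign (P : Finset (HeightOneSpectrum (𝓞 K)))
    (N : Set (InfinitePlace K)) :
    ∃ t : K, t ≠ 0 ∧ (∀ v ∈ P, v.valuation K (t - 1) < 1) ∧
      ∀ (w : InfinitePlace K) (hw : w.IsReal),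
        (w ∈ N → InfinitePlace.Completion.extensionEmbeddingOfIsReal hw (algebraMap K w.Completion t) < 0) ∧
        (w ∉ N → 0 < InfinitePlace.Completion.extensionEmbeddingOfIsReal hw (algebraMap K w.Completion t)) := by
  classical
  -- without real places `t = 1` will do
  by_cases hreal : ∃ w₀ : InfinitePlace K, w₀.IsReal
  swap
  · refine ⟨1, one_ne_zero, fun v _ => by rw [sub_self, map_zero]; exact zero_lt_one, fun w hw => ?_⟩
    exact absurd ⟨w, hw⟩ hreal
  obtain ⟨w₀, hw₀⟩ := hreal
  -- an integral element `y` with the prescribed signs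
  obtain ⟨y₀, hy₀0, hy₀⟩ := exists_forall_isReal_sign K N
  obtain ⟨d, y, hd, hdy⟩ := exists_nat_mul_mem_ringOfIntegers K y₀
  -- the real embeddings and the signs of `y`
  let σ : ∀ w : InfinitePlace K, w.IsReal → (K →+* ℝ) := fun w hw =>
    (InfinitePlace.Completion.extensionEmbeddingOfIsReal hw).comp (algebraMap K w.Completion)
  have hσ : ∀ (w : InfinitePlace K) (hw : w.IsReal) (x : K),
      σ w hw x = InfinitePlace.Completion.extensionEmbeddingOfIsReal hw (algebraMap K w.Completion x) :=
    fun _ _ _ => rfl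
  have hyσ : ∀ (w : InfinitePlace K) (hw : w.IsReal), σ w hw (y : K) = d * σ w hw y₀ := by
    intro w hw
    rw [← hdy, map_mul, map_natCast]
  have hyneg : ∀ (w : InfinitePlace K) (hw : w.IsReal), w ∈ N → σ w hw (y : K) < 0 := fun w hw hN => by
    rw [hyσ]
    exact mul_neg_of_pos_of_neg (Nat.cast_pos.mpr hd) ((hy₀ w hw).1 hN)
  have hypos : ∀ (w : InfinitePlace K) (hw : w.IsReal), w ∉ N → 0 < σ w hw (y : K) := fun w hw hN => by
    rw [hyσ]
    exact mul_pos (Nat.cast_pos.mpr hd) ((hy₀ w hw).2 hN)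
  have hyne : ∀ (w : InfinitePlace K) (hw : w.IsReal), σ w hw (y : K) ≠ 0 := fun w hw => by
    by_cases hN : w ∈ N
    · exact (hyneg w hw hN).ne
    · exact (hypos w hw hN).ne'
  -- `M = ∏_{v ∈ P} N(𝔭_v)` lies in every `𝔭_v`, `v ∈ P`
  set M : ℕ := ∏ v ∈ P, Ideal.absNorm v.asIdeal with hM
  have hMmem : ∀ v ∈ P, (M : 𝓞 K) ∈ v.asIdeal := by
    intro v hv
    rw [hM, ← Finset.mul_prod_erase P _ hv, Nat.cast_mul]
    exact Ideal.mul_mem_right _ _ (Ideal.absNorm_mem v.asIdeal)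
  have hM0 : 0 < M := by
    rw [hM]
    refine Finset.prod_pos fun v _ => Nat.pos_of_ne_zero ?_
    rw [ne_eq, Ideal.absNorm_eq_zero_iff]
    exact v.ne_bot
  have hM1 : (1 : ℝ) ≤ M := by exact_mod_cast hM0
  -- `D` large: `D · |σ_w y| > 1` at every real place
  let f : InfinitePlace K → ℕ := fun w => if hw : w.IsReal then ⌈1 / |σ w hw (y : K)|⌉₊ else 0
  set D : ℕ := Finset.univ.sup f + 1 with hD
  have hDgt : ∀ (w : InfinitePlace K) (hw : w.IsReal), 1 < (D : ℝ) * |σ w hw (y : K)| := by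
    intro w hw
    have habs : 0 < |σ w hw (y : K)| := abs_pos.mpr (hyne w hw)
    have hfw : f w ≤ Finset.univ.sup f := Finset.le_sup (Finset.mem_univ w)
    have hf : (1 / |σ w hw (y : K)| : ℝ) ≤ f w := by
      simp only [f, dif_pos hw]
      exact Nat.le_ceil _
    have hDw : (1 / |σ w hw (y : K)| : ℝ) < D := by
      calc (1 / |σ w hw (y : K)| : ℝ) ≤ f w := hf
        _ < (Finset.univ.sup f : ℕ) + 1 := by exact_mod_cast Nat.lt_succ_of_le hfw
        _ = D := by rw [hD]; push_cast; ring
    exact (div_lt_iff₀ habs).mp hDw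
  -- the element `t = 1 + M D y`
  set t : K := 1 + (M : K) * (D : K) * (y : K) with ht
  have htσ : ∀ (w : InfinitePlace K) (hw : w.IsReal), σ w hw t = 1 + (M : ℝ) * D * σ w hw (y : K) := by
    intro w hw
    rw [ht, map_add, map_one, map_mul, map_mul, map_natCast, map_natCast]
  have hbig : ∀ (w : InfinitePlace K) (hw : w.IsReal), 1 < |(M : ℝ) * D * σ w hw (y : K)| := by
    intro w hw
    rw [abs_mul, abs_mul, Nat.abs_cast, Nat.abs_cast, mul_assoc]
    calc (1 : ℝ) < (D : ℝ) * |σ w hw (y : K)| := hDgt w hw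
      _ ≤ M * ((D : ℝ) * |σ w hw (y : K)|) := le_mul_of_one_le_left (by positivity) hM1
  have hsign : ∀ (w : InfinitePlace K) (hw : w.IsReal),
      (w ∈ N → σ w hw t < 0) ∧ (w ∉ N → 0 < σ w hw t) := by
    intro w hw
    have hb := hbig w hw
    constructor
    · intro hN
      have hneg : (M : ℝ) * D * σ w hw (y : K) < 0 :=
        mul_neg_of_pos_of_neg (by positivity) (hyneg w hw hN)
      rw [abs_of_neg hneg] at hb
      rw [htσ]
      linarith
    · intro hN
      have hpos : 0 < (M : ℝ) * D * σ w hw (y : K) := by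
        have := hypos w hw hN
        positivity
      rw [htσ]
      linarith
  refine ⟨t, fun h0 => ?_, fun v hv => ?_, fun w hw => ?_⟩
  · -- `t ≠ 0`: its sign at the real place `w₀` is determined
    have h := hsign w₀ hw₀
    rw [h0, map_zero] at h
    by_cases hN : w₀ ∈ N
    · exact lt_irrefl _ (h.1 hN)
    · exact lt_irrefl _ (h.2 hN)
  · -- `|t - 1|_v < 1`: `t - 1 = M · (D y) ∈ 𝔭_v`
    have hmem : (M : 𝓞 K) * ((D : 𝓞 K) * y) ∈ v.asIdeal := Ideal.mul_mem_right _ _ (hMmem v hv)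
    have h := (v.valuation_lt_one_iff_mem (K := K) ((M : 𝓞 K) * ((D : 𝓞 K) * y))).mpr hmem
    have hcoe : (algebraMap (𝓞 K) K ((M : 𝓞 K) * ((D : 𝓞 K) * y))) = t - 1 := by
      rw [ht, map_mul, map_mul, map_natCast, map_natCast, add_sub_cancel_left, mul_assoc]
    rw [← hcoe]
    exact h
  · exact hsign w hw

/-- **Tate's CRT element, totally positive**: for disjoint finite sets `S`, `T` of finite places and
exponents `e : S → ℕ` there is `a ∈ Kˣ` with `ord_{K_v}(a) = e_v` for `v ∈ S`, `|a - 1|_w < 1` for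
`w ∈ T`, and `a >_w 0` at EVERY REAL PLACE `w` of `K` (`exists_ord_eq_and_valuation_sub_one_lt` times an
element `≡ 1 (mod S ∪ T)` with the same signs, `exists_valuation_sub_one_lt_and_forall_isReal_sign`).
[cite: NeukirchANT1999, Ch. II §3 Thm. (3.4)] [cite: CasselsFrohlichANT1967, Ch. VII §11] -/
theorem exists_ord_eq_and_valuation_sub_one_lt_and_pos (S T : Finset (HeightOneSpectrum (𝓞 K)))
    (hST : Disjoint S T) (e : HeightOneSpectrum (𝓞 K) → ℕ) :
    ∃ a : K, a ≠ 0 ∧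
      (∀ v ∈ S, ord (v.adicCompletion K) (algebraMap K (v.adicCompletion K) a) = e v) ∧
      (∀ w ∈ T, w.valuation K (a - 1) < 1) ∧
      ∀ (w : InfinitePlace K) (hw : w.IsReal),
        0 < InfinitePlace.Completion.extensionEmbeddingOfIsReal hw (algebraMap K w.Completion a) := by
  classical
  obtain ⟨a₀, ha₀, hord, hone⟩ := exists_ord_eq_and_valuation_sub_one_lt S T hST e
  -- the real places where `a₀` is negative
  set N : Set (InfinitePlace K) := {w | ∃ hw : w.IsReal,
    InfinitePlace.Completion.extensionEmbeddingOfIsReal hw (algebraMap K w.Completion a₀) < 0} with hN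
  obtain ⟨t, ht0, htone, htsign⟩ := exists_valuation_sub_one_lt_and_forall_isReal_sign K (S ∪ T) N
  -- `t` is a unit at `S ∪ T`
  have htval : ∀ v ∈ S ∪ T, v.valuation K t = 1 := by
    intro v hv
    have h := htone v hv
    have : t = 1 + (t - 1) := by ring
    rw [this]
    exact Valuation.map_one_add_of_lt _ h
  refine ⟨a₀ * t, mul_ne_zero ha₀ ht0, fun v hv => ?_, fun w hw => ?_, fun w hw => ?_⟩
  · -- orders at `S` unchanged
    have hordt : ord (v.adicCompletion K) (algebraMap K (v.adicCompletion K) t) = 0 :=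
      ord_adicCompletion_algebraMap_eq_of_valuation_eq v ht0 (by
        rw [htval v (Finset.mem_union_left T hv), neg_zero, WithZero.exp_zero])
    rw [map_mul, ord_mul (v.adicCompletion K)
      ((map_ne_zero_iff _ (algebraMap K _).injective).2 ha₀)
      ((map_ne_zero_iff _ (algebraMap K _).injective).2 ht0), hord v hv, hordt, add_zero]
  · -- congruence at `T`: `a₀ t - 1 = a₀ (t - 1) + (a₀ - 1)`
    have h1 : w.valuation K (a₀ - 1) < 1 := hone w hw
    have ha₀v : w.valuation K a₀ = 1 := by
      have : a₀ = 1 + (a₀ - 1) := by ring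
      rw [this]
      exact Valuation.map_one_add_of_lt _ h1
    have h2 : w.valuation K (a₀ * (t - 1)) < 1 := by
      rw [map_mul, ha₀v, one_mul]
      exact htone w (Finset.mem_union_right S hw)
    have hdec : a₀ * t - 1 = a₀ * (t - 1) + (a₀ - 1) := by ring
    rw [hdec]
    exact lt_of_le_of_lt (Valuation.map_add _ _ _) (max_lt h2 h1)
  · -- positivity at the real places
    rw [map_mul, map_mul]
    have ha₀ne : InfinitePlace.Completion.extensionEmbeddingOfIsReal hw (algebraMap K w.Completion a₀) ≠ 0 := by
      rw [map_ne_zero_iff _ (InfinitePlace.Completion.extensionEmbeddingOfIsReal hw).injective,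
        map_ne_zero_iff _ (algebraMap K w.Completion).injective]
      exact ha₀
    by_cases hneg : InfinitePlace.Completion.extensionEmbeddingOfIsReal hw (algebraMap K w.Completion a₀) < 0
    · have hwN : w ∈ N := ⟨hw, hneg⟩
      exact mul_pos_of_neg_of_neg hneg ((htsign w hw).1 hwN)
    · have hwN : w ∉ N := by
        rintro ⟨hw', h'⟩
        exact hneg h'
      exact mul_pos (lt_of_le_of_ne (not_lt.mp hneg) ha₀ne.symm) ((htsign w hw).2 hwN)

end Literature.NumberTheory.NumberFields

end
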